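import Literature.Analysis.InnerProduct.ClosedDenselyDefinedHilbertComplex
import HarnessLib

/-!
# Hörmander's Theorem 1.1.4: the modified basic estimate `‖Af‖² ≤ ‖T*f‖² + ‖Sf‖²` on `D_{T*} ∩ D_S ∩ F`
# gives `R_{A*} ∩ N_S ∩ F ⊆ R_T` with `Tu = A*h`, `‖u‖ ≤ ‖h‖`, and `T*f = v` with `‖Af‖ ≤ ‖v‖`
# (L. Hörmander, Acta Math. 113 (1965), §1.1 Theorem 1.1.4)

Layer `Literature/Analysis/InnerProduct`, namespace `Literature.Analysis.InnerProduct`; sequel BY NAME of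
`AdjointRangeEstimate.lean` (the Hahn–Banach/Riesz step `exists_inner_eq_of_norm_inner_le` of Hörmander's
book Lemma 4.1.1) and of `ClosedDenselyDefinedHilbertComplex.lean` (von Neumann / Demailly VIII Thm 1.1–1.2:
`adjoint_adjoint_of_isClosed`, `dense_adjoint_domain_of_isClosed`, `orthogonal_range_eq_ker_adjoint`,
`closure_range_le_ker`, `mem_pmapKer_iff`, `isClosed_pmapKer`; the decomposition pattern of
`norm_inner_le_of_estimate`). Lane `lit-hodgefound` (Track 2 foundations library), prover seat
`lit-hodgefound-p06` (generation 31), self-proposed row g31-#8; companion of row g31-#7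
(`HilbertComplexBasicEstimate.lean`, Theorems 1.1.1–1.1.3). THEOREMS ONLY (no definition, no named fact).
Unbounded operators are Mathlib's `LinearPMap` (`T : E →ₗ.[𝕜] F`, `T†` = `LinearPMap.adjoint`); `N_S = Ker S`
is `(LinearMap.ker S.toFun).map S.domain.subtype`, `R_T = LinearMap.range T.toFun`.

## Source, verbatim (L. Hörmander, *L² estimates and existence theorems for the ∂̄ operator*, Acta Math. 113
(1965), §1.1 pp. 93–94; held text `paper:doi-10-1007-bf02391775`, p0005–p0006)

"In the applications we shall also encounter modified forms of (1.1.4):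

THEOREM 1.1.4. Let `A` be a closed, densely defined, linear operator in `H₂`, and let `F` be a closed subspace
of `H₂` which contains `R_T`. Assume that (1.1.6) `‖Af‖₂² ≤ ‖T*f‖₁² + ‖Sf‖₃²; f ∈ D_{T*} ∩ D_S ∩ F`, which in
particular shall mean that `f ∈ D_{T*} ∩ D_S ∩ F` implies `f ∈ D_A`. Then we have `R_{A*} ∩ N_S ∩ F ⊂ R_T`;
if `g = A*h`, `h ∈ D_{A*}`, and `g ∈ N_S ∩ F`, we can find `u ∈ D_T` so that `Tu = g` and `‖u‖₁ ≤ ‖h‖₂`.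
Furthermore, if `v ∈ R_{T*}`, we can choose `f ∈ D_A ∩ D_{T*}` so that `T*f = v` and `‖Af‖₂ ≤ ‖v‖₁`.

Proof. With `g` and `h` as in the theorem we have to find `u ∈ H₁` so that `‖u‖₁ ≤ ‖h‖₂` and `Tu = g`, that
is, `(u, T*f)₁ = (g, f)₂, f ∈ D_{T*}`. By the Hahn-Banach theorem this is equivalent to proving the
inequality (1.1.7) `|(g, f)₂| ≤ ‖h‖₂‖T*f‖₁, f ∈ D_{T*}`. First note that if `f ⊥ N_S ∩ F`, we have `T*f = 0`
because `R_T ⊂ N_S ∩ F`. Since `g ∈ N_S ∩ F`, it is therefore enough to prove (1.1.7) when `f ∈ N_S ∩ F`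
and `f ∈ D_{T*}`. But then we obtain from (1.1.6) that `‖Af‖₂ ≤ ‖T*f‖₁`, which gives
`|(g, f)₂| = |(A*h, f)₂| = |(h, Af)₂| ≤ ‖h‖₂‖Af‖₂ ≤ ‖h‖₂‖T*f‖₁`. This proves (1.1.7) and the first part of
the theorem. To prove the second part we note that the range of `T*` is equal to the range of its
restriction to the orthogonal complement of `N_{T*}`, that is `[R_T]`, which is contained in `N_S ∩ F`. Hence
one can find `f ∈ N_S ∩ F ∩ D_{T*}` so that `T*f = v`. But then it follows from (1.1.6) that `f ∈ D_A` and
that `‖Af‖₂ ≤ ‖v‖₁. The proof is complete."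

(The estimate (1.1.6) is applied in the paper through Theorem 2.1.4 / (2.1.16),
`∫ Σ φ_{jk} f_{I,jK} f̄_{I,kK} e^{-φ} dV ≤ ‖T*f‖²_φ + ‖Sf‖²_φ`, i.e. with `A` a multiplication operator and `F = H₂`
— "Combination of Proposition 2.1.1 and Theorem 2.1.4 with the first part of Theorem 1.1.4 (with `F = H₂`) gives"
Theorem 2.2.1, p. 104.)

## What is proved (all over `𝕜 = ℝ` or `ℂ`, i.e. `RCLike 𝕜`; Hörmander states complex Hilbert spaces)

For closed densely defined `T : E →ₗ.[𝕜] F`, `S : F →ₗ.[𝕜] G` with `R_T ⊆ N_S`, a densely defined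
`A : F →ₗ.[𝕜] K` (the paper has `K = H₂ = F`; the target space plays no role, and the closedness of `A` is not
used), a closed subspace `F' ⊇ R_T` of `F`, and (1.1.6) stated as: every `f ∈ D_{T*} ∩ D_S ∩ F'` lies in `D_A`
and `‖Af‖² ≤ ‖T*f‖² + ‖Sf‖²`:
* (1.1.7) **`norm_inner_adjoint_le_of_modified_estimate`** (`|(A*h, f)| ≤ ‖h‖ ‖T*f‖` for `f ∈ D_{T*}` when
  `A*h ∈ N_S ∩ F'` — the orthogonal splitting `f = f′ + f″` of the printed proof);
* **`exists_preimage_adjoint_of_modified_estimate`** (first part: `Tu = A*h` with `‖u‖ ≤ ‖h‖`) and the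
  inclusion **`range_adjoint_inf_ker_inf_le_range`** (`R_{A*} ∩ N_S ∩ F' ⊆ R_T`); the case `F' = H₂` used in the
  paper, `exists_preimage_adjoint_of_modified_estimate_top`;
* **`exists_adjoint_solution_of_modified_estimate`** (second part: every `v ∈ R_{T*}` is `T*f` with
  `f ∈ N_S ∩ F' ∩ D_{T*} ∩ D_A` and `‖Af‖ ≤ ‖v‖`; neither the closedness of `T` nor the density of `D_A` is
  needed for this half).

## References

* [Hormander1965] L. Hörmander, *L² estimates and existence theorems for the ∂̄ operator*, Acta Math. 113
  (1965), 89–152, §1.1 Theorem 1.1.4, (1.1.6)–(1.1.7) (and §2.2 Thm 2.2.1 for the use with `F = H₂`).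
* [HormanderSCV1973] L. Hörmander, *An Introduction to Complex Analysis in Several Variables* (1973), §4.1,
  Lemma 4.1.1 (the Hahn–Banach step, through `AdjointRangeEstimate.lean`).
* [DemaillyAGBook] J.-P. Demailly, *Complex Analytic and Differential Geometry*, Ch. VIII §1 Thm 1.1–1.2
  (`T** = T`, `(R_T)^⊥ = N_{T*}`, through `ClosedDenselyDefinedHilbertComplex.lean`).
-/

noncomputable section

open scoped InnerProductSpace LinearPMap

namespace Literature.Analysis.InnerProduct

variable {𝕜 E F G K : Type*} [RCLike 𝕜]
variable [NormedAddCommGroup E] [InnerProductSpace 𝕜 E] [CompleteSpace E]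
variable [NormedAddCommGroup F] [InnerProductSpace 𝕜 F] [CompleteSpace F]
variable [NormedAddCommGroup G] [InnerProductSpace 𝕜 G]
variable [NormedAddCommGroup K] [InnerProductSpace 𝕜 K]
variable {T : E →ₗ.[𝕜] F} {S : F →ₗ.[𝕜] G} {A : F →ₗ.[𝕜] K} {F' : Submodule 𝕜 F}

/-- **(1.1.7): under (1.1.6), if `g = A*h ∈ N_S ∩ F` then `|(g, f)| ≤ ‖h‖ ‖T*f‖` for every `f ∈ D_{T*}`**
("if `f ⊥ N_S ∩ F`, we have `T*f = 0` because `R_T ⊂ N_S ∩ F`. Since `g ∈ N_S ∩ F`, it is therefore enough to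
prove (1.1.7) when `f ∈ N_S ∩ F` and `f ∈ D_{T*}`. But then we obtain from (1.1.6) that `‖Af‖ ≤ ‖T*f‖`, which
gives `|(g, f)| = |(A*h, f)| = |(h, Af)| ≤ ‖h‖‖Af‖ ≤ ‖h‖‖T*f‖`": split `f = f′ + f″` along the closed subspace
`N_S ∩ F` and its orthogonal complement). [cite: Hormander1965, §1.1 Thm 1.1.4 (proof, (1.1.7))] -/
theorem norm_inner_adjoint_le_of_modified_estimate (hdT : Dense (T.domain : Set E)) (hcS : S.IsClosed)
    (hST : LinearMap.range T.toFun ≤ (LinearMap.ker S.toFun).map S.domain.subtype)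
    (hdA : Dense (A.domain : Set F)) (hFc : IsClosed (F' : Set F)) (hTF : LinearMap.range T.toFun ≤ F')
    (h16 : ∀ (f : F) (hfT : f ∈ T†.domain) (hfS : f ∈ S.domain), f ∈ F' →
      ∃ hfA : f ∈ A.domain, ‖A ⟨f, hfA⟩‖ ^ 2 ≤ ‖T† ⟨f, hfT⟩‖ ^ 2 + ‖S ⟨f, hfS⟩‖ ^ 2)
    (h : A†.domain) (hgS : A† h ∈ (LinearMap.ker S.toFun).map S.domain.subtype) (hgF : A† h ∈ F')
    (f : T†.domain) : ‖⟪A† h, (f : F)⟫_𝕜‖ ≤ ‖(h : K)‖ * ‖T† f‖ := by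
  set W : Submodule 𝕜 F := (LinearMap.ker S.toFun).map S.domain.subtype ⊓ F' with hW
  have hWc : IsClosed (W : Set F) := by
    rw [hW, Submodule.coe_inf]; exact (isClosed_pmapKer hcS).inter hFc
  haveI : CompleteSpace W := hWc.completeSpace_coe
  have hmem : (f : F) ∈ W ⊔ Wᗮ := by
    rw [Submodule.sup_orthogonal_of_hasOrthogonalProjection]; exact Submodule.mem_top
  obtain ⟨f', hf', f'', hf'', hsum⟩ := Submodule.mem_sup.1 hmem
  -- `f″ ⊥ N_S ∩ F ⊇ R_T`, so `f″ ∈ (R_T)^⊥ = N_{T*}`: `T* f″ = 0`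
  have hTW : LinearMap.range T.toFun ≤ W := le_inf hST hTF
  have hf''K : f'' ∈ (LinearMap.ker T†.toFun).map T†.domain.subtype := by
    rw [← orthogonal_range_eq_ker_adjoint hdT]; exact Submodule.orthogonal_le hTW hf''
  obtain ⟨hf''T, hTf''⟩ := mem_pmapKer_iff.1 hf''K
  -- `f′ = f − f″ ∈ D_{T*}`, `T* f′ = T* f`, `S f′ = 0`, `f′ ∈ F`
  have hf'eq : f' = (f : F) - f'' := eq_sub_of_add_eq hsum
  have hf'T : f' ∈ T†.domain := by rw [hf'eq]; exact T†.domain.sub_mem f.2 hf''T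
  have hTf' : T† ⟨f', hf'T⟩ = T† f := by
    have hsub : (⟨f', hf'T⟩ : T†.domain) = f - ⟨f'', hf''T⟩ := Subtype.ext (by simpa using hf'eq)
    rw [hsub, LinearPMap.map_sub, hTf'', sub_zero]
  obtain ⟨hf'S, hSf'⟩ := mem_pmapKer_iff.1 (Submodule.mem_inf.1 hf').1
  have hf'F : f' ∈ F' := (Submodule.mem_inf.1 hf').2
  -- (1.1.6) at `f′`: `‖A f′‖ ≤ ‖T* f‖`
  obtain ⟨hf'A, h16'⟩ := h16 f' hf'T hf'S hf'F
  have hAf' : ‖A ⟨f', hf'A⟩‖ ≤ ‖T† f‖ := by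
    rw [hSf', norm_zero, zero_pow two_ne_zero, add_zero, hTf'] at h16'
    exact (pow_le_pow_iff_left₀ (norm_nonneg _) (norm_nonneg _) two_ne_zero).1 h16'
  -- `(g, f) = (g, f′) = (A*h, f′) = (h, A f′)`
  have hgW : A† h ∈ W := Submodule.mem_inf.2 ⟨hgS, hgF⟩
  have hgf : ⟪A† h, (f : F)⟫_𝕜 = ⟪A† h, f'⟫_𝕜 := by
    rw [← hsum, inner_add_right, Submodule.inner_right_of_mem_orthogonal hgW hf'', add_zero]
  have hadj : ⟪A† h, f'⟫_𝕜 = ⟪(h : K), A ⟨f', hf'A⟩⟫_𝕜 := (LinearPMap.adjoint_isFormalAdjoint hdA) h ⟨f', hf'A⟩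
  calc ‖⟪A† h, (f : F)⟫_𝕜‖ = ‖⟪(h : K), A ⟨f', hf'A⟩⟫_𝕜‖ := by rw [hgf, hadj]
    _ ≤ ‖(h : K)‖ * ‖A ⟨f', hf'A⟩‖ := norm_inner_le_norm _ _
    _ ≤ ‖(h : K)‖ * ‖T† f‖ := by gcongr

/-- **Theorem 1.1.4, first part: under (1.1.6), if `g = A*h`, `h ∈ D_{A*}`, and `g ∈ N_S ∩ F`, there is
`u ∈ D_T` with `Tu = g` and `‖u‖ ≤ ‖h‖`** ("we have to find `u ∈ H₁` so that `‖u‖₁ ≤ ‖h‖₂` and …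
`(u, T*f)₁ = (g, f)₂, f ∈ D_{T*}`. By the Hahn-Banach theorem this is equivalent to proving the inequality
(1.1.7)"; then `u ∈ D_{T**} = D_T` and `T**u = g`). [cite: Hormander1965, §1.1 Thm 1.1.4] -/
theorem exists_preimage_adjoint_of_modified_estimate (hdT : Dense (T.domain : Set E)) (hcT : T.IsClosed)
    (hcS : S.IsClosed) (hST : LinearMap.range T.toFun ≤ (LinearMap.ker S.toFun).map S.domain.subtype)
    (hdA : Dense (A.domain : Set F)) (hFc : IsClosed (F' : Set F)) (hTF : LinearMap.range T.toFun ≤ F')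
    (h16 : ∀ (f : F) (hfT : f ∈ T†.domain) (hfS : f ∈ S.domain), f ∈ F' →
      ∃ hfA : f ∈ A.domain, ‖A ⟨f, hfA⟩‖ ^ 2 ≤ ‖T† ⟨f, hfT⟩‖ ^ 2 + ‖S ⟨f, hfS⟩‖ ^ 2)
    (h : A†.domain) (hgS : A† h ∈ (LinearMap.ker S.toFun).map S.domain.subtype) (hgF : A† h ∈ F') :
    ∃ u : T.domain, T u = A† h ∧ ‖(u : E)‖ ≤ ‖(h : K)‖ := by
  obtain ⟨u, hu, hweak⟩ := exists_inner_eq_of_norm_inner_le (T†.toFun) (norm_nonneg (h : K))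
    (fun f ↦ norm_inner_adjoint_le_of_modified_estimate hdT hcS hST hdA hFc hTF h16 h hgS hgF f)
  -- `u ∈ Dom T** = Dom T` and `T u = g`
  have hkey : ∀ x : T†.domain, ⟪A† h, (x : F)⟫_𝕜 = ⟪u, T† x⟫_𝕜 := fun x ↦ (hweak x).symm
  have hudom : u ∈ T††.domain := LinearPMap.mem_adjoint_domain_of_exists _ ⟨A† h, hkey⟩
  have hTu : T†† ⟨u, hudom⟩ = A† h :=
    LinearPMap.adjoint_apply_eq (dense_adjoint_domain_of_isClosed hdT hcT) ⟨u, hudom⟩ hkey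
  have hle : T†† ≤ T := le_of_eq (adjoint_adjoint_of_isClosed hdT hcT)
  refine ⟨⟨u, hle.1 hudom⟩, ?_, hu⟩
  rw [← hle.2 (rfl : ((⟨u, hudom⟩ : T††.domain) : E) = ((⟨u, hle.1 hudom⟩ : T.domain) : E)), hTu]

/-- **Theorem 1.1.4, first part as an inclusion: `R_{A*} ∩ N_S ∩ F ⊆ R_T`.** [cite: Hormander1965, §1.1 Thm 1.1.4] -/
theorem range_adjoint_inf_ker_inf_le_range (hdT : Dense (T.domain : Set E)) (hcT : T.IsClosed)
    (hcS : S.IsClosed) (hST : LinearMap.range T.toFun ≤ (LinearMap.ker S.toFun).map S.domain.subtype)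
    (hdA : Dense (A.domain : Set F)) (hFc : IsClosed (F' : Set F)) (hTF : LinearMap.range T.toFun ≤ F')
    (h16 : ∀ (f : F) (hfT : f ∈ T†.domain) (hfS : f ∈ S.domain), f ∈ F' →
      ∃ hfA : f ∈ A.domain, ‖A ⟨f, hfA⟩‖ ^ 2 ≤ ‖T† ⟨f, hfT⟩‖ ^ 2 + ‖S ⟨f, hfS⟩‖ ^ 2) :
    LinearMap.range A†.toFun ⊓ ((LinearMap.ker S.toFun).map S.domain.subtype ⊓ F') ≤
      LinearMap.range T.toFun := by
  rintro g ⟨⟨h, rfl⟩, hgS, hgF⟩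
  obtain ⟨u, hTu, -⟩ := exists_preimage_adjoint_of_modified_estimate hdT hcT hcS hST hdA hFc hTF h16 h hgS hgF
  exact ⟨u, hTu⟩

/-- **Theorem 1.1.4, first part with `F = H₂`** (the form used for Theorem 2.2.1: "with the first part of
Theorem 1.1.4 (with `F = H₂`)"): if every `f ∈ D_{T*} ∩ D_S` lies in `D_A` with `‖Af‖² ≤ ‖T*f‖² + ‖Sf‖²`, then
every `A*h ∈ N_S` is `Tu` with `‖u‖ ≤ ‖h‖`. [cite: Hormander1965, §1.1 Thm 1.1.4 / §2.2 Thm 2.2.1] -/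
theorem exists_preimage_adjoint_of_modified_estimate_top (hdT : Dense (T.domain : Set E)) (hcT : T.IsClosed)
    (hcS : S.IsClosed) (hST : LinearMap.range T.toFun ≤ (LinearMap.ker S.toFun).map S.domain.subtype)
    (hdA : Dense (A.domain : Set F))
    (h16 : ∀ (f : F) (hfT : f ∈ T†.domain) (hfS : f ∈ S.domain),
      ∃ hfA : f ∈ A.domain, ‖A ⟨f, hfA⟩‖ ^ 2 ≤ ‖T† ⟨f, hfT⟩‖ ^ 2 + ‖S ⟨f, hfS⟩‖ ^ 2)
    (h : A†.domain) (hgS : A† h ∈ (LinearMap.ker S.toFun).map S.domain.subtype) :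
    ∃ u : T.domain, T u = A† h ∧ ‖(u : E)‖ ≤ ‖(h : K)‖ :=
  exists_preimage_adjoint_of_modified_estimate (F' := ⊤) hdT hcT hcS hST hdA
    (by rw [Submodule.top_coe]; exact isClosed_univ) le_top (fun f hfT hfS _ ↦ h16 f hfT hfS) h hgS
    Submodule.mem_top

/-- **Theorem 1.1.4, second part: under (1.1.6), every `v ∈ R_{T*}` is `T*f` for some
`f ∈ N_S ∩ F ∩ D_{T*}`, which then lies in `D_A` with `‖Af‖ ≤ ‖v‖`** ("the range of `T*` is equal to the range
of its restriction to the orthogonal complement of `N_{T*}`, that is `[R_T]`, which is contained in `N_S ∩ F`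
… But then it follows from (1.1.6) that `f ∈ D_A` and that `‖Af‖₂ ≤ ‖v‖₁`"; `f` is `f₀` minus its projection
onto the closed subspace `N_{T*} ⊆ D_{T*}`, and `N_{T*}^⊥ = (R_T)^{⊥⊥} = [R_T]`).
[cite: Hormander1965, §1.1 Thm 1.1.4 (second part)] -/
theorem exists_adjoint_solution_of_modified_estimate (hdT : Dense (T.domain : Set E)) (hcS : S.IsClosed)
    (hST : LinearMap.range T.toFun ≤ (LinearMap.ker S.toFun).map S.domain.subtype)
    (hFc : IsClosed (F' : Set F)) (hTF : LinearMap.range T.toFun ≤ F')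
    (h16 : ∀ (f : F) (hfT : f ∈ T†.domain) (hfS : f ∈ S.domain), f ∈ F' →
      ∃ hfA : f ∈ A.domain, ‖A ⟨f, hfA⟩‖ ^ 2 ≤ ‖T† ⟨f, hfT⟩‖ ^ 2 + ‖S ⟨f, hfS⟩‖ ^ 2)
    {v : E} (hv : v ∈ LinearMap.range T†.toFun) :
    ∃ (f : F) (hfT : f ∈ T†.domain) (hfA : f ∈ A.domain), T† ⟨f, hfT⟩ = v ∧ ‖A ⟨f, hfA⟩‖ ≤ ‖v‖ ∧
      f ∈ (LinearMap.ker S.toFun).map S.domain.subtype ∧ f ∈ F' := by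
  obtain ⟨f₀, rfl⟩ := hv
  set N : Submodule 𝕜 F := (LinearMap.ker T†.toFun).map T†.domain.subtype with hN
  haveI : CompleteSpace N := (isClosed_pmapKer (LinearPMap.adjoint_isClosed hdT)).completeSpace_coe
  obtain ⟨hPdom, hP0⟩ := mem_pmapKer_iff.1 (N.starProjection_apply_mem (f₀ : F))
  set f : F := (f₀ : F) - N.starProjection f₀ with hf
  have hfT : f ∈ T†.domain := T†.domain.sub_mem f₀.2 hPdom
  have hTf : T† ⟨f, hfT⟩ = T† f₀ := by
    have hsplit : (⟨f, hfT⟩ : T†.domain) = f₀ - ⟨N.starProjection f₀, hPdom⟩ := rfl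
    rw [hsplit, LinearPMap.map_sub, hP0, sub_zero]
  -- `f ∈ N_{T*}^⊥ = (R_T)^{⊥⊥} = [R_T] ⊆ N_S ∩ F`
  have hfcl : f ∈ (LinearMap.range T.toFun).topologicalClosure := by
    rw [← Submodule.orthogonal_orthogonal_eq_closure, orthogonal_range_eq_ker_adjoint hdT]
    exact N.sub_starProjection_mem_orthogonal (f₀ : F)
  have hfS' : f ∈ (LinearMap.ker S.toFun).map S.domain.subtype := closure_range_le_ker hcS hST hfcl
  have hfF : f ∈ F' := Submodule.topologicalClosure_minimal _ hTF hFc hfcl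
  obtain ⟨hfS, hSf⟩ := mem_pmapKer_iff.1 hfS'
  obtain ⟨hfA, h16'⟩ := h16 f hfT hfS hfF
  refine ⟨f, hfT, hfA, hTf, ?_, hfS', hfF⟩
  rw [hSf, norm_zero, zero_pow two_ne_zero, add_zero, hTf] at h16'
  exact (pow_le_pow_iff_left₀ (norm_nonneg _) (norm_nonneg _) two_ne_zero).1 h16'

end Literature.Analysis.InnerProduct
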